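/-
Copyright (c) 2026 the pub-hodgecm-mathlib formalisation cell (harness21).  Prover seat hodgecm-mathlib-K2E4-p10 (g7), Track B ∕ K2-LIT, h413 = `stmt-HodgeConjecture-24833`,
line `K2_E1_TraceFormulaBeta`, 5Res ROADCARD «ENDGAME BY FAMILIES» §3′ M2 v2, D-road letter `hTB` (K2E1-plan (g7) (244)∕(248)(a)∕(250)): the COMPRESSION COMMUTATION `hTB` of ★ D5′
(`K2E1IrreducibleNoContinuousSpectrumU` ∕ `…CMTwoOfLetters`) from the operator algebra of pure tensors + Gelfand's trick (★ A1 `K2E1KTypeCompressionAverageU`).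
-/
import Summits.HodgeConjecture.HodgeConjecture.Theorems.K2E1KTypeCompressionAverageU     -- ★ A1 p860591 (this seat): `exists_spherical_compression`, `commute_compression_of_gelfand`; brings ★ p860461, ★ p860372, ★ p860333
import Summits.HodgeConjecture.HodgeConjecture.Theorems.K2E1HeckeAlgebraLettersCM        -- ★ (K2E4-p23): `mem_eqLocus_of_idem`, `apply_eq_of_mem_eqLocus`, the `cmDatum` block-projector currency
import HarnessLib

/-!
# D-road `hTB` — `K2E1CompressionCommuteOfSphericalU`: ON THE BLOCK `V_P = {P v = v}`, `P = P_χ ∘ R₂(e)`, THE HECKE OPERATOR `T = R₁(h) ∘ R₂(e)` (`h` `χ`-SPHERICAL) COMMUTES WITH THE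
# COMPRESSIONS OF THE PURE TENSORS: `P (A (T x)) = T (P (A x))` for `A = R₁(a) ∘ R₂(b)`, `x ∈ V_P` — the letter `hTB` of ★ D5′ p860349 ∕ ★ p860487, generic + `U(H)(𝔸_{L⁺})` prints

Track B ∕ K2-LIT, crux h413 = `stmt-HodgeConjecture-24833`, route of record `HCCMUnconditional`; cell `hodgecm-mathlib`, squad K2, ENGINE E1 (5Res campaign, M2 v2 D-road).  THEOREMS ONLY
(no `def`, no `instance`, no `notation`, no named-fact hypothesis, no `sorry`; default heartbeats); lane `--supports stmt-HodgeConjecture-24833 --as helper` (count-neutral).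
THE MATHEMATICS ([Knapp1986, VIII §3]; [DeitmarEchterhoff2014, Prop. 6.2.1]; [Helgason2000, IV §3]; ROADCARD §3′.1 amendment #2 (228) (S2), ruling (244)).  With `E = R₂(e)` idempotent
commuting with the idempotent `P_χ` (separate variables), a vector of the block `x = P_χ(E x)` satisfies `E x = x = P_χ x`; pushing the finite factors through (`R₁ ∘ R₂ = R₂ ∘ R₁`, ★ p860333
`integratedOperator_restrict_comm`; `P_χ ∘ R₂ = R₂ ∘ P_χ`, ★ `comp_integratedOperator_comm_of_forall`) both sides of `hTB` become, with `y := E(R₂(b) x)` (again `P_χ y = y`),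
`P_χ R₁(a) R₁(h) y = (P_χ R₁(a) P_χ)(R₁(h) y)` and `R₁(h) P_χ R₁(a) y = R₁(h)((P_χ R₁(a) P_χ) y)` (using `R₁(h)P_χ = P_χR₁(h)`, ★ `hh_of_spherical`) — so **`hTB` IS EXACTLY THE
COMMUTATION OF `R₁(h)` WITH THE COMPRESSIONS `P_χ R₁(a) P_χ`** (§1 `hTB_of_commute_compression`, letter `hcommC`), which ★ A1 `commute_compression_of_gelfand` delivers from Gelfand's trick
(the compression is `R₁(a♮)` with `a♮` `χ`-spherical; ★ p860461) — §2 `hTB_of_gelfand` with the Gelfand letters `θ hθmul hθη hconj` visible (K2E2-p12: ★ p860494∕p860556 discharge `hθη` at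
the archimedean place, `hKconj` in flight).  §3 prints both at `cmDatum L N H` in the binder shapes of ★ p860487 `indicator_lpSMul_blockProj_eq_zero_of_irreducible_subrep_cm` (`T j = R_∞(h_j) ∘L R_f(e)`).
* §1 `eq_of_mem_eqLocus_comp` (`E x = x`, `P_χ x = x` on the block), **`hTB_of_commute_compression`**.  * §2 **`hTB_of_gelfand`**.  * §3 **`cm_hTB_of_commute_compression`**, **`cm_hTB_of_gelfand`**.
HONEST LABEL: HC_CM is proved only modulo the 7 printed citations (2 remaining named inputs: hLiu418 = `stmt-HodgeConjecture-24832`, h413 = `stmt-HodgeConjecture-24833`) until rung 0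
closes; this file asserts no named fact and closes no socket; count-neutral; letters visible: `hcommC` (§1∕§3) or the Gelfand data `θ hθmul hθη hconj` (§2∕§3), `χ`-sphericality of the `h_j`.

## References
* [Knapp1986] A. W. Knapp, *Representation Theory of Semisimple Groups* (1986), VIII §3.
* [DeitmarEchterhoff2014] A. Deitmar, S. Echterhoff, *Principles of Harmonic Analysis* (2nd ed., 2014), Prop. 6.2.1, Lemma 1.6.3.
* [Helgason2000] S. Helgason, *Groups and Geometric Analysis* (2000), Ch. IV §3, Thm. 3.1.
-/

set_option autoImplicit false
set_option linter.dupNamespace false -- the mandated namespace repeats `HodgeConjecture.HodgeConjecture`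

noncomputable section

open MeasureTheory Filter Topology CompactlySupported NumberField
open Literature.NumberTheory.Automorphic Literature.NumberTheory.Automorphic.UnitaryGroup AdelicGroupData
open Summit.HodgeConjecture.HodgeConjecture.Cruxes.H413.K2E1PureTensorHeckeAlgebraU (comp_integratedOperator_comm_of_forall integratedOperator_restrict_comm cm_hcomm)
open Summit.HodgeConjecture.HodgeConjecture.Cruxes.H413.K2E1KTypeProjectorPureTensorU (kType_comm_restrict kType_comp_self level_comp_self hh_of_spherical)
open Summit.HodgeConjecture.HodgeConjecture.Cruxes.H413.K2E1KTypeCompressionAverageU (commute_compression_of_gelfand)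

namespace Summit.HodgeConjecture.HodgeConjecture.Cruxes.H413.K2E1CompressionCommuteOfSphericalU

/-! ## §1 Generic: `hTB` from the commutation with the compressions -/

section Generic

variable {G G₁ G₂ V : Type*} [Group G] [TopologicalSpace G]
  [Group G₁] [TopologicalSpace G₁] [MeasurableSpace G₁] [BorelSpace G₁]
  [Group G₂] [TopologicalSpace G₂] [MeasurableSpace G₂] [BorelSpace G₂]
  [NormedAddCommGroup V] [InnerProductSpace ℂ V] [CompleteSpace V]
  (π : ContRepresentation ℂ G V) (hu : π.IsUnitary) (hc : π.IsStronglyContinuous)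
  (ι₁ : G₁ →* G) (hι₁ : Continuous ι₁) (ι₂ : G₂ →* G) (hι₂ : Continuous ι₂)
  (η₁ : Measure G₁) (η₂ : Measure G₂) [IsFiniteMeasureOnCompacts η₁] [IsFiniteMeasureOnCompacts η₂]

omit [CompleteSpace V] in
/-- **ON THE BLOCK `x = P(E x)` ONE HAS `E x = x` AND `P x = x`** when `P`, `E` are idempotents with `P ∘ E = E ∘ P`. [folklore] -/
theorem eq_of_mem_eqLocus_comp (P E : V →L[ℂ] V) (hPP : P ∘L P = P) (hEE : E ∘L E = E) (hPE : P ∘L E = E ∘L P)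
    {x : V} (hx : x ∈ LinearMap.eqLocus ((P ∘L E : V →L[ℂ] V) : V →ₗ[ℂ] V) LinearMap.id) : E x = x ∧ P x = x := by
  have h0 : P (E x) = x := by
    have h := LinearMap.mem_eqLocus.1 hx
    simpa using h
  have hPEx : ∀ v, P (E v) = E (P v) := fun v => by
    rw [← ContinuousLinearMap.comp_apply, hPE, ContinuousLinearMap.comp_apply]
  constructor
  · calc E x = E (P (E x)) := by rw [h0]
      _ = P (E (E x)) := (hPEx (E x)).symm
      _ = P (E x) := by rw [← ContinuousLinearMap.comp_apply E E, hEE]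
      _ = x := h0
  · calc P x = P (P (E x)) := by rw [h0]
      _ = P (E x) := by rw [← ContinuousLinearMap.comp_apply P P, hPP]
      _ = x := h0

/-- **`hTB` FROM THE COMMUTATION WITH THE COMPRESSIONS.**  Let `P : V →L V` commute with every `π(ι₂ y)` and be idempotent (E1: the `K`-type projector `P_χ`), `E = R₂(e)` idempotent (the level
projector), `h ∈ C_c(G₁)` with `R₁(h) ∘ P = P ∘ R₁(h)` (★ `hh_of_spherical`) and **`hcommC : ∀ a, Commute (R₁ h) (P ∘L R₁ a ∘L P)`** (★ A1 `commute_compression_of_gelfand`).  THEN for every pure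
tensor `A = R₁(a) ∘ R₂(b)` and every `x` of the block `{(P ∘ E) x = x}`: **`(P ∘ E)(A(T x)) = T((P ∘ E)(A x))`**, `T = R₁(h) ∘ E` — the hypothesis `hTB` of ★ D5′ p860349 (with `P ∘L E` for its `P`).
[cite: Knapp1986, VIII §3] [cite: DeitmarEchterhoff2014, Prop. 6.2.1] -/
theorem hTB_of_commute_compression (hcomm : ∀ (x : G₁) (y : G₂), ι₁ x * ι₂ y = ι₂ y * ι₁ x)
    (P : V →L[ℂ] V) (hP : ∀ y : G₂, P ∘L π (ι₂ y) = π (ι₂ y) ∘L P) (hPP : P ∘L P = P)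
    (e : C_c(G₂, ℂ)) (hee : (π.restrict ι₂).integratedOperator (hu.restrict ι₂) (hc.restrict ι₂ hι₂) η₂ e ∘L (π.restrict ι₂).integratedOperator (hu.restrict ι₂) (hc.restrict ι₂ hι₂) η₂ e =
      (π.restrict ι₂).integratedOperator (hu.restrict ι₂) (hc.restrict ι₂ hι₂) η₂ e)
    (h : C_c(G₁, ℂ)) (hh : (π.restrict ι₁).integratedOperator (hu.restrict ι₁) (hc.restrict ι₁ hι₁) η₁ h ∘L P = P ∘L (π.restrict ι₁).integratedOperator (hu.restrict ι₁) (hc.restrict ι₁ hι₁) η₁ h)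
    (hcommC : ∀ a : C_c(G₁, ℂ), Commute ((π.restrict ι₁).integratedOperator (hu.restrict ι₁) (hc.restrict ι₁ hι₁) η₁ h)
      (P ∘L (π.restrict ι₁).integratedOperator (hu.restrict ι₁) (hc.restrict ι₁ hι₁) η₁ a ∘L P)) :
    ∀ A ∈ {A : V →L[ℂ] V | ∃ (a : C_c(G₁, ℂ)) (b : C_c(G₂, ℂ)),
        A = (π.restrict ι₁).integratedOperator (hu.restrict ι₁) (hc.restrict ι₁ hι₁) η₁ a ∘L (π.restrict ι₂).integratedOperator (hu.restrict ι₂) (hc.restrict ι₂ hι₂) η₂ b},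
      ∀ x ∈ LinearMap.eqLocus ((P ∘L (π.restrict ι₂).integratedOperator (hu.restrict ι₂) (hc.restrict ι₂ hι₂) η₂ e : V →L[ℂ] V) : V →ₗ[ℂ] V) LinearMap.id,
        (P ∘L (π.restrict ι₂).integratedOperator (hu.restrict ι₂) (hc.restrict ι₂ hι₂) η₂ e)
            (A (((π.restrict ι₁).integratedOperator (hu.restrict ι₁) (hc.restrict ι₁ hι₁) η₁ h ∘L (π.restrict ι₂).integratedOperator (hu.restrict ι₂) (hc.restrict ι₂ hι₂) η₂ e) x)) =
          ((π.restrict ι₁).integratedOperator (hu.restrict ι₁) (hc.restrict ι₁ hι₁) η₁ h ∘L (π.restrict ι₂).integratedOperator (hu.restrict ι₂) (hc.restrict ι₂ hι₂) η₂ e)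
            ((P ∘L (π.restrict ι₂).integratedOperator (hu.restrict ι₂) (hc.restrict ι₂ hι₂) η₂ e) (A x)) := by
  rintro _ ⟨a, b, rfl⟩ x hx
  -- names for the four operators
  set Ra : V →L[ℂ] V := (π.restrict ι₁).integratedOperator (hu.restrict ι₁) (hc.restrict ι₁ hι₁) η₁ a with hRa
  set Rh : V →L[ℂ] V := (π.restrict ι₁).integratedOperator (hu.restrict ι₁) (hc.restrict ι₁ hι₁) η₁ h with hRh
  set Rb : V →L[ℂ] V := (π.restrict ι₂).integratedOperator (hu.restrict ι₂) (hc.restrict ι₂ hι₂) η₂ b with hRb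
  set E : V →L[ℂ] V := (π.restrict ι₂).integratedOperator (hu.restrict ι₂) (hc.restrict ι₂ hι₂) η₂ e with hE
  -- commutations: `P` with every `R₂ f`, `R₁` with `R₂`, `R₁ h` with `P`; idempotence of `E`; the compression commutation
  have cPE : ∀ w : V, P (E w) = E (P w) := fun w => by
    rw [hE, ← ContinuousLinearMap.comp_apply, comp_integratedOperator_comm_of_forall π hu hc ι₂ hι₂ η₂ P hP e, ContinuousLinearMap.comp_apply]
  have cPb : ∀ w : V, P (Rb w) = Rb (P w) := fun w => by
    rw [hRb, ← ContinuousLinearMap.comp_apply, comp_integratedOperator_comm_of_forall π hu hc ι₂ hι₂ η₂ P hP b, ContinuousLinearMap.comp_apply]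
  have caE : ∀ w : V, E (Ra w) = Ra (E w) := fun w => by
    rw [hE, hRa, ← ContinuousLinearMap.comp_apply, ← integratedOperator_restrict_comm π hu hc ι₁ hι₁ ι₂ hι₂ η₁ η₂ hcomm a e, ContinuousLinearMap.comp_apply]
  have chE : ∀ w : V, E (Rh w) = Rh (E w) := fun w => by
    rw [hE, hRh, ← ContinuousLinearMap.comp_apply, ← integratedOperator_restrict_comm π hu hc ι₁ hι₁ ι₂ hι₂ η₁ η₂ hcomm h e, ContinuousLinearMap.comp_apply]
  have chb : ∀ w : V, Rb (Rh w) = Rh (Rb w) := fun w => by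
    rw [hRb, hRh, ← ContinuousLinearMap.comp_apply, ← integratedOperator_restrict_comm π hu hc ι₁ hι₁ ι₂ hι₂ η₁ η₂ hcomm h b, ContinuousLinearMap.comp_apply]
  have chP : ∀ w : V, Rh (P w) = P (Rh w) := fun w => by rw [hRh, ← ContinuousLinearMap.comp_apply, hh, ContinuousLinearMap.comp_apply]
  have hEE' : ∀ w : V, E (E w) = E w := fun w => by rw [hE, ← ContinuousLinearMap.comp_apply, hee]
  have hC : ∀ w : V, Rh (P (Ra (P w))) = P (Ra (P (Rh w))) := fun w => by
    have h' := congrArg (fun T : V →L[ℂ] V => T w) (hcommC a).eq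
    simpa only [ContinuousLinearMap.mul_def, ContinuousLinearMap.comp_apply] using h'
  -- the block facts `E x = x`, `P x = x`, and `P y = y` for `y = E (R₂ b x)`
  have hPE : P ∘L E = E ∘L P := by rw [hE]; exact comp_integratedOperator_comm_of_forall π hu hc ι₂ hι₂ η₂ P hP e
  obtain ⟨hEx, hPx⟩ := eq_of_mem_eqLocus_comp P E hPP hee hPE hx
  have hy : P (E (Rb x)) = E (Rb x) := by rw [cPE, cPb, hPx]
  -- both sides reduce to the compression commutation applied to `y`
  simp only [ContinuousLinearMap.comp_apply]
  calc P (E (Ra (Rb (Rh (E x))))) = P (Ra (Rh (E (Rb x)))) := by rw [hEx, chb, caE, chE]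
    _ = P (Ra (P (Rh (E (Rb x))))) := by rw [← chP, hy]
    _ = Rh (P (Ra (P (E (Rb x))))) := (hC _).symm
    _ = Rh (P (Ra (E (Rb x)))) := by rw [hy]
    _ = Rh (E (P (E (Ra (Rb x))))) := by rw [← caE, cPE, hEE']

end Generic

/-! ## §2 Generic: `hTB` from Gelfand's trick (★ A1 plugged) -/

section Gelfand

variable {G G₁ G₂ K V : Type*} [Group G] [TopologicalSpace G]
  [Group G₁] [TopologicalSpace G₁] [IsTopologicalGroup G₁] [LocallyCompactSpace G₁] [SecondCountableTopology G₁] [MeasurableSpace G₁] [BorelSpace G₁] [MeasurableMul G₁]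
  [Group G₂] [TopologicalSpace G₂] [MeasurableSpace G₂] [BorelSpace G₂]
  [Group K] [TopologicalSpace K] [IsTopologicalGroup K] [CompactSpace K] [MeasurableSpace K] [BorelSpace K] [MeasurableMul K]
  [NormedAddCommGroup V] [InnerProductSpace ℂ V] [CompleteSpace V]
  (π : ContRepresentation ℂ G V) (hu : π.IsUnitary) (hc : π.IsStronglyContinuous)
  (ι₁ : G₁ →* G) (hι₁ : Continuous ι₁) (ι₂ : G₂ →* G) (hι₂ : Continuous ι₂) (κ : K →* G₁) (hκ : Continuous κ)
  (μ : Measure K) [IsFiniteMeasureOnCompacts μ] [IsProbabilityMeasure μ] [μ.IsMulLeftInvariant] [μ.IsMulRightInvariant] (χ : C_c(K, ℂ))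
  (η₁ : Measure G₁) [IsFiniteMeasureOnCompacts η₁] [SFinite η₁] [η₁.IsMulLeftInvariant] [η₁.IsMulRightInvariant] [η₁.IsInvInvariant]
  (η₂ : Measure G₂) [IsFiniteMeasureOnCompacts η₂]

include hκ in
/-- **`hTB` FROM GELFAND'S TRICK** (`P = P_χ ∘L R₂(e)`, `T = R₁(h) ∘L R₂(e)`, `h` `χ`-spherical): the hypotheses of §1 are discharged by ★ p860372 (`kType_comm_restrict`, `kType_comp_self`,
`hh_of_spherical`) and ★ A1 `commute_compression_of_gelfand` (letters: the anti-automorphism `θ` with `hθmul`, `hθη`, and the `K`-conjugacy `hconj`; the level idempotence `hee`).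
[cite: Helgason2000, IV §3, Thm. 3.1] [cite: Knapp1986, VIII §3] -/
theorem hTB_of_gelfand (hcomm : ∀ (x : G₁) (y : G₂), ι₁ x * ι₂ y = ι₂ y * ι₁ x) (hχmul : ∀ k l, χ (k * l) = χ k * χ l) (hχone : χ 1 = 1)
    (θ : G₁ ≃ₜ G₁) (hθmul : ∀ x y : G₁, θ (x * y) = θ y * θ x) (hθη : MeasurePreserving θ η₁ η₁) (hconj : ∀ g : G₁, ∃ k : K, θ g = κ k * g * (κ k)⁻¹)
    (e : C_c(G₂, ℂ)) (hee : (π.restrict ι₂).integratedOperator (hu.restrict ι₂) (hc.restrict ι₂ hι₂) η₂ e ∘L (π.restrict ι₂).integratedOperator (hu.restrict ι₂) (hc.restrict ι₂ hι₂) η₂ e =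
      (π.restrict ι₂).integratedOperator (hu.restrict ι₂) (hc.restrict ι₂ hι₂) η₂ e)
    (h : C_c(G₁, ℂ)) (hhl : ∀ (k : K) (x : G₁), h (κ k * x) = χ k * h x) (hhr : ∀ (k : K) (x : G₁), h (x * κ k) = χ k * h x) :
    ∀ A ∈ {A : V →L[ℂ] V | ∃ (a : C_c(G₁, ℂ)) (b : C_c(G₂, ℂ)),
        A = (π.restrict ι₁).integratedOperator (hu.restrict ι₁) (hc.restrict ι₁ hι₁) η₁ a ∘L (π.restrict ι₂).integratedOperator (hu.restrict ι₂) (hc.restrict ι₂ hι₂) η₂ b},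
      ∀ x ∈ LinearMap.eqLocus (((π.restrict (ι₁.comp κ)).integratedOperator (hu.restrict (ι₁.comp κ)) (hc.restrict (ι₁.comp κ) (hι₁.comp hκ)) μ χ ∘L
          (π.restrict ι₂).integratedOperator (hu.restrict ι₂) (hc.restrict ι₂ hι₂) η₂ e : V →L[ℂ] V) : V →ₗ[ℂ] V) LinearMap.id,
        ((π.restrict (ι₁.comp κ)).integratedOperator (hu.restrict (ι₁.comp κ)) (hc.restrict (ι₁.comp κ) (hι₁.comp hκ)) μ χ ∘L (π.restrict ι₂).integratedOperator (hu.restrict ι₂) (hc.restrict ι₂ hι₂) η₂ e)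
            (A (((π.restrict ι₁).integratedOperator (hu.restrict ι₁) (hc.restrict ι₁ hι₁) η₁ h ∘L (π.restrict ι₂).integratedOperator (hu.restrict ι₂) (hc.restrict ι₂ hι₂) η₂ e) x)) =
          ((π.restrict ι₁).integratedOperator (hu.restrict ι₁) (hc.restrict ι₁ hι₁) η₁ h ∘L (π.restrict ι₂).integratedOperator (hu.restrict ι₂) (hc.restrict ι₂ hι₂) η₂ e)
            (((π.restrict (ι₁.comp κ)).integratedOperator (hu.restrict (ι₁.comp κ)) (hc.restrict (ι₁.comp κ) (hι₁.comp hκ)) μ χ ∘L (π.restrict ι₂).integratedOperator (hu.restrict ι₂) (hc.restrict ι₂ hι₂) η₂ e) (A x)) :=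
  hTB_of_commute_compression π hu hc ι₁ hι₁ ι₂ hι₂ η₁ η₂ hcomm _ (kType_comm_restrict π hu hc ι₁ hι₁ ι₂ κ hκ μ χ hcomm) (kType_comp_self π hu hc ι₁ hι₁ κ hκ μ χ hχmul hχone) e hee h
    (hh_of_spherical π hu hc ι₁ hι₁ κ hκ μ χ η₁ hχmul hχone h hhl hhr)
    (fun a => commute_compression_of_gelfand π hu hc ι₁ hι₁ κ hκ μ χ hχmul η₁ θ hθmul hθη hχone hconj h hhl hhr a)

end Gelfand

/-! ## §3 The `U(H)(𝔸_{L⁺})` prints in the binder shapes of ★ p860487 -/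

section CM

variable {L : Type} [Field L] [NumberField L] [IsCMField L] {N : ℕ} {H : Matrix (Fin N) (Fin N) L}
  {K V : Type*} [Group K] [TopologicalSpace K] [MeasurableSpace K] [BorelSpace K]
  [NormedAddCommGroup V] [InnerProductSpace ℂ V] [CompleteSpace V]
  (π : ContRepresentation ℂ (cmDatum L N H).Adelic V) (hu : π.IsUnitary) (hc : π.IsStronglyContinuous)
  [MeasurableSpace (UnitaryGroup.arch (↥(maximalRealSubfield L)) L (IsCMField.complexConj L) N H)] [BorelSpace (UnitaryGroup.arch (↥(maximalRealSubfield L)) L (IsCMField.complexConj L) N H)]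
  [MeasurableSpace (finAdelic (↥(maximalRealSubfield L)) L (IsCMField.complexConj L) N H)] [BorelSpace (finAdelic (↥(maximalRealSubfield L)) L (IsCMField.complexConj L) N H)]
  (νinf : Measure (UnitaryGroup.arch (↥(maximalRealSubfield L)) L (IsCMField.complexConj L) N H)) [IsFiniteMeasureOnCompacts νinf] [νinf.IsMulLeftInvariant] [νinf.IsMulRightInvariant]
  (νf : Measure (finAdelic (↥(maximalRealSubfield L)) L (IsCMField.complexConj L) N H)) [IsFiniteMeasureOnCompacts νf] [νf.IsMulLeftInvariant]
  (κ : K →* UnitaryGroup.arch (↥(maximalRealSubfield L)) L (IsCMField.complexConj L) N H) (hκ : Continuous κ)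
  (μ : Measure K) [IsFiniteMeasureOnCompacts μ] [IsProbabilityMeasure μ] [MeasurableMul K] [μ.IsMulLeftInvariant] (χ : C_c(K, ℂ))
  (e : C_c(finAdelic (↥(maximalRealSubfield L)) L (IsCMField.complexConj L) N H, ℂ)) {J : Type*}

/-- **`hTB` AT `U(H)(𝔸_{L⁺})` FROM THE COMPRESSION COMMUTATION** — EXACTLY the binder `hTB` of ★ p860487 `indicator_lpSMul_blockProj_eq_zero_of_irreducible_subrep_cm` for the Hecke operators
`T j = R_∞(h_j) ∘L R_f(e)` (`h_j` `χ`-spherical for `κ : K →* U(H)(L⁺ ⊗ ℝ)`), given `hcommC : Commute (R_∞ h_j) (P_χ ∘L R_∞ a ∘L P_χ)` for all `a` (★ A1 `commute_compression_of_gelfand` at the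
archimedean place; §3 `cm_hTB_of_gelfand`).  The level∕character data are ★ p860487's (`hχmul hχone K′ he0 he1 heK`, `P` with `hPdef`). [cite: Knapp1986, VIII §3] [cite: DeitmarEchterhoff2014, Prop. 6.2.1] -/
theorem cm_hTB_of_commute_compression
    (hχmul : ∀ k l, χ (k * l) = χ k * χ l) (hχone : χ 1 = 1)
    (K' : Subgroup (finAdelic (↥(maximalRealSubfield L)) L (IsCMField.complexConj L) N H)) (he0 : ∀ x, x ∉ K' → e x = 0) (he1 : ∫ x, e x ∂νf = 1)
    (heK : ∀ k ∈ K', ∀ x, e (k * x) = e x)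
    (P : V →L[ℂ] V) (hPdef : P = ((π.restrict ((archToAdelic (↥(maximalRealSubfield L)) L (IsCMField.complexConj L) N H).comp κ)).integratedOperator (hu.restrict _)
          (hc.restrict _ ((continuous_archToAdelic (↥(maximalRealSubfield L)) L (IsCMField.complexConj L) N H).comp hκ)) μ χ ∘L
        (π.restrict (finAdelicToAdelic (↥(maximalRealSubfield L)) L (IsCMField.complexConj L) N H)).integratedOperator (hu.restrict _) (hc.restrict _ (continuous_finAdelicToAdelic (↥(maximalRealSubfield L)) L (IsCMField.complexConj L) N H)) νf e))
    (h : J → C_c(UnitaryGroup.arch (↥(maximalRealSubfield L)) L (IsCMField.complexConj L) N H, ℂ))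
    (hhl : ∀ (j : J) (k : K) (x : UnitaryGroup.arch (↥(maximalRealSubfield L)) L (IsCMField.complexConj L) N H), h j (κ k * x) = χ k * h j x)
    (hhr : ∀ (j : J) (k : K) (x : UnitaryGroup.arch (↥(maximalRealSubfield L)) L (IsCMField.complexConj L) N H), h j (x * κ k) = χ k * h j x)
    (T : J → V →L[ℂ] V) (hTdef : ∀ j, T j = (π.restrict (archToAdelic (↥(maximalRealSubfield L)) L (IsCMField.complexConj L) N H)).integratedOperator (hu.restrict _)
          (hc.restrict _ (continuous_archToAdelic (↥(maximalRealSubfield L)) L (IsCMField.complexConj L) N H)) νinf (h j) ∘L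
        (π.restrict (finAdelicToAdelic (↥(maximalRealSubfield L)) L (IsCMField.complexConj L) N H)).integratedOperator (hu.restrict _) (hc.restrict _ (continuous_finAdelicToAdelic (↥(maximalRealSubfield L)) L (IsCMField.complexConj L) N H)) νf e)
    (hcommC : ∀ (j : J) (a : C_c(UnitaryGroup.arch (↥(maximalRealSubfield L)) L (IsCMField.complexConj L) N H, ℂ)),
      Commute ((π.restrict (archToAdelic (↥(maximalRealSubfield L)) L (IsCMField.complexConj L) N H)).integratedOperator (hu.restrict _)
          (hc.restrict _ (continuous_archToAdelic (↥(maximalRealSubfield L)) L (IsCMField.complexConj L) N H)) νinf (h j))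
        ((π.restrict ((archToAdelic (↥(maximalRealSubfield L)) L (IsCMField.complexConj L) N H).comp κ)).integratedOperator (hu.restrict _)
            (hc.restrict _ ((continuous_archToAdelic (↥(maximalRealSubfield L)) L (IsCMField.complexConj L) N H).comp hκ)) μ χ ∘L
          (π.restrict (archToAdelic (↥(maximalRealSubfield L)) L (IsCMField.complexConj L) N H)).integratedOperator (hu.restrict _)
            (hc.restrict _ (continuous_archToAdelic (↥(maximalRealSubfield L)) L (IsCMField.complexConj L) N H)) νinf a ∘L
          (π.restrict ((archToAdelic (↥(maximalRealSubfield L)) L (IsCMField.complexConj L) N H).comp κ)).integratedOperator (hu.restrict _)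
            (hc.restrict _ ((continuous_archToAdelic (↥(maximalRealSubfield L)) L (IsCMField.complexConj L) N H).comp hκ)) μ χ)) :
    ∀ j, ∀ A ∈ {A : V →L[ℂ] V | ∃ (a : C_c(UnitaryGroup.arch (↥(maximalRealSubfield L)) L (IsCMField.complexConj L) N H, ℂ)) (b : C_c(finAdelic (↥(maximalRealSubfield L)) L (IsCMField.complexConj L) N H, ℂ)),
      A = (π.restrict (archToAdelic (↥(maximalRealSubfield L)) L (IsCMField.complexConj L) N H)).integratedOperator (hu.restrict _) (hc.restrict _ (continuous_archToAdelic (↥(maximalRealSubfield L)) L (IsCMField.complexConj L) N H)) νinf a ∘L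
          (π.restrict (finAdelicToAdelic (↥(maximalRealSubfield L)) L (IsCMField.complexConj L) N H)).integratedOperator (hu.restrict _) (hc.restrict _ (continuous_finAdelicToAdelic (↥(maximalRealSubfield L)) L (IsCMField.complexConj L) N H)) νf b},
      ∀ x ∈ LinearMap.eqLocus (P : V →ₗ[ℂ] V) LinearMap.id, P (A (T j x)) = T j (P (A x)) := by
  intro j
  subst hPdef
  rw [hTdef j]
  exact hTB_of_commute_compression π hu hc _ (continuous_archToAdelic (↥(maximalRealSubfield L)) L (IsCMField.complexConj L) N H)
    _ (continuous_finAdelicToAdelic (↥(maximalRealSubfield L)) L (IsCMField.complexConj L) N H) νinf νf cm_hcomm _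
    (kType_comm_restrict π hu hc _ (continuous_archToAdelic (↥(maximalRealSubfield L)) L (IsCMField.complexConj L) N H) _ κ hκ μ χ cm_hcomm)
    (kType_comp_self π hu hc _ (continuous_archToAdelic (↥(maximalRealSubfield L)) L (IsCMField.complexConj L) N H) κ hκ μ χ hχmul hχone)
    e (level_comp_self _ (hu.restrict _) (hc.restrict _ (continuous_finAdelicToAdelic (↥(maximalRealSubfield L)) L (IsCMField.complexConj L) N H)) νf K' e he0 he1 heK) (h j)
    (hh_of_spherical π hu hc _ (continuous_archToAdelic (↥(maximalRealSubfield L)) L (IsCMField.complexConj L) N H) κ hκ μ χ νinf hχmul hχone (h j) (hhl j) (hhr j)) (hcommC j)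

include hκ in
/-- **`hTB` AT `U(H)(𝔸_{L⁺})` FROM GELFAND'S TRICK** — the same with `hcommC` DISCHARGED by ★ A1 `commute_compression_of_gelfand` at the archimedean place: letters = an anti-automorphic
homeomorphism `θ` of `U(H)(L⁺ ⊗ ℝ)` preserving `ν_∞` (K2E2-p12 ★ p860494∕p860556: transpose, `hθη` discharged) and the `K`-conjugacy `hconj` (`hKconj`, ★ p859876 at `N = 2`); `K` compact,
`μ` two-sided invariant. [cite: Helgason2000, IV §3, Thm. 3.1] [cite: Knapp1986, VIII §3] -/
theorem cm_hTB_of_gelfand [CompactSpace K] [IsTopologicalGroup K] [μ.IsMulRightInvariant] [SFinite νinf] [νinf.IsInvInvariant]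
    (hχmul : ∀ k l, χ (k * l) = χ k * χ l) (hχone : χ 1 = 1)
    (K' : Subgroup (finAdelic (↥(maximalRealSubfield L)) L (IsCMField.complexConj L) N H)) (he0 : ∀ x, x ∉ K' → e x = 0) (he1 : ∫ x, e x ∂νf = 1)
    (heK : ∀ k ∈ K', ∀ x, e (k * x) = e x)
    (P : V →L[ℂ] V) (hPdef : P = ((π.restrict ((archToAdelic (↥(maximalRealSubfield L)) L (IsCMField.complexConj L) N H).comp κ)).integratedOperator (hu.restrict _)
          (hc.restrict _ ((continuous_archToAdelic (↥(maximalRealSubfield L)) L (IsCMField.complexConj L) N H).comp hκ)) μ χ ∘L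
        (π.restrict (finAdelicToAdelic (↥(maximalRealSubfield L)) L (IsCMField.complexConj L) N H)).integratedOperator (hu.restrict _) (hc.restrict _ (continuous_finAdelicToAdelic (↥(maximalRealSubfield L)) L (IsCMField.complexConj L) N H)) νf e))
    (θ : UnitaryGroup.arch (↥(maximalRealSubfield L)) L (IsCMField.complexConj L) N H ≃ₜ UnitaryGroup.arch (↥(maximalRealSubfield L)) L (IsCMField.complexConj L) N H)
    (hθmul : ∀ x y, θ (x * y) = θ y * θ x) (hθη : MeasurePreserving θ νinf νinf)
    (hconj : ∀ g : UnitaryGroup.arch (↥(maximalRealSubfield L)) L (IsCMField.complexConj L) N H, ∃ k : K, θ g = κ k * g * (κ k)⁻¹)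
    (h : J → C_c(UnitaryGroup.arch (↥(maximalRealSubfield L)) L (IsCMField.complexConj L) N H, ℂ))
    (hhl : ∀ (j : J) (k : K) (x : UnitaryGroup.arch (↥(maximalRealSubfield L)) L (IsCMField.complexConj L) N H), h j (κ k * x) = χ k * h j x)
    (hhr : ∀ (j : J) (k : K) (x : UnitaryGroup.arch (↥(maximalRealSubfield L)) L (IsCMField.complexConj L) N H), h j (x * κ k) = χ k * h j x)
    (T : J → V →L[ℂ] V) (hTdef : ∀ j, T j = (π.restrict (archToAdelic (↥(maximalRealSubfield L)) L (IsCMField.complexConj L) N H)).integratedOperator (hu.restrict _)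
          (hc.restrict _ (continuous_archToAdelic (↥(maximalRealSubfield L)) L (IsCMField.complexConj L) N H)) νinf (h j) ∘L
        (π.restrict (finAdelicToAdelic (↥(maximalRealSubfield L)) L (IsCMField.complexConj L) N H)).integratedOperator (hu.restrict _) (hc.restrict _ (continuous_finAdelicToAdelic (↥(maximalRealSubfield L)) L (IsCMField.complexConj L) N H)) νf e) :
    ∀ j, ∀ A ∈ {A : V →L[ℂ] V | ∃ (a : C_c(UnitaryGroup.arch (↥(maximalRealSubfield L)) L (IsCMField.complexConj L) N H, ℂ)) (b : C_c(finAdelic (↥(maximalRealSubfield L)) L (IsCMField.complexConj L) N H, ℂ)),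
      A = (π.restrict (archToAdelic (↥(maximalRealSubfield L)) L (IsCMField.complexConj L) N H)).integratedOperator (hu.restrict _) (hc.restrict _ (continuous_archToAdelic (↥(maximalRealSubfield L)) L (IsCMField.complexConj L) N H)) νinf a ∘L
          (π.restrict (finAdelicToAdelic (↥(maximalRealSubfield L)) L (IsCMField.complexConj L) N H)).integratedOperator (hu.restrict _) (hc.restrict _ (continuous_finAdelicToAdelic (↥(maximalRealSubfield L)) L (IsCMField.complexConj L) N H)) νf b},
      ∀ x ∈ LinearMap.eqLocus (P : V →ₗ[ℂ] V) LinearMap.id, P (A (T j x)) = T j (P (A x)) :=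
  cm_hTB_of_commute_compression π hu hc νinf νf κ hκ μ χ e hχmul hχone K' he0 he1 heK P hPdef h hhl hhr T hTdef fun j a =>
    commute_compression_of_gelfand π hu hc _ (continuous_archToAdelic (↥(maximalRealSubfield L)) L (IsCMField.complexConj L) N H) κ hκ μ χ hχmul νinf θ hθmul hθη hχone hconj (h j) (hhl j) (hhr j) a

end CM

end Summit.HodgeConjecture.HodgeConjecture.Cruxes.H413.K2E1CompressionCommuteOfSphericalU

end
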